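import Mathlib
import Summits.KontsevichZagierPeriods.Zeta5Search.CatalanRemarksUT
import Summits.KontsevichZagierPeriods.Zeta5Search.Denom.CatalanQBridgeProof
import HarnessLib

/-!
# Catalan box family — Zudilin's SECOND recursion: `den ũ_n = 2^{4n−5−2s₂(n−1)}` exactly, and `2^{4n} ũ_n ∈ ℤ` for every `n`

HONEST FRAMING: systematic search; no irrationality claim unless certified.

Cell `pub-zeta5`, planner seat `fam-catalan` (gen 7); sequel to `CatalanRemarksUT` (`uT_eq_box`: Zudilin's `ũ_n`, the solution of the second
Apéry-like recursion (13) of arXiv:math/0210423, Theorem 2, is `(−1)^{n−1}(n/2)·catalanQ(n−1,n,n,n−1,n+1)`).  Transporting the tree's two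
arithmetic laws for the box evaluator `CatalanQSum.catalanQ` — the 2-adic law `CatalanQSum.twoAdicLaw_holds` (fam-catalan gen 3) and fam-denom's
dyadic law `Denom.CatalanBox.dyadicLaw_holds` (no odd prime in a reduced denominator) — through that identification gives, for Zudilin's
sequence itself:
* `padicValRat_uT` : `v₂(ũ_n) = 5 − 4n + 2 s₂(n−1)` for `n ≥ 1` (`s₂` = binary digit sum; `s2_succ_add_padicValNat` is Legendre's
  `s₂(m+1) + v₂(m+1) = s₂(m) + 1`);
* `den_uT` : `den ũ_n = 2^{4n−5−2s₂(n−1)}` EXACTLY, for every `n` (truncated subtraction: `den ũ₀ = den ũ₁ = 1`);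
* `two_pow_mul_uT_isInt` : `2^{4n} ũ_n ∈ ℤ` for EVERY `n` — the `u`-half of the inclusions (14) of [Zudilin 2002, Thm 2] = clause (iii) of the
  UNPROVED named fact `Zudilin2003.remarksTheorem2`, with the exponent `4n + o(n)` of print replaced by `4n` (print: "`o(n)` of order
  `log₂(2n)`"; here `o(n) = −5 − 2s₂(n−1) < 0`); uniformly sharper `two_pow_sub_mul_uT_isInt` : `2^{4n−7} ũ_n ∈ ℤ` for `n ≥ 2`, an equality
  of denominators exactly when `n − 1` is a power of `2`;
* `uT_arithmetic` bundles the four statements.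
NOT addressed: the `ṽ`-half `2^{4n+o(n)} D²_{2n−1} ṽ_n ∈ ℤ` of (14) (its odd part is invisible to the recursion), the series (12) and the
growth clauses of Theorem 2.
-/

namespace Summit.KontsevichZagierPeriods.Zeta5Search.CatalanRemarksUTDenominator

open Literature.NumberTheory.Irrationality
open Literature.NumberTheory.Irrationality.Zudilin2003 (uT)
open Summit.KontsevichZagierPeriods.Zeta5Search.CatalanQSum
open Summit.KontsevichZagierPeriods.Zeta5Search.CatalanRemarksUT

/-! ### The 2-adic valuation, the exact denominator and the inclusion `2^{4n} ũ_n ∈ ℤ` -/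

/-- Binary digit sums along `m ↦ m+1`: `s₂(m+1) + v₂(m+1) = s₂(m) + 1` (Legendre). -/
theorem s2_succ_add_padicValNat (m : ℕ) :
    ((Nat.digits 2 (m + 1)).sum : ℤ) + padicValNat 2 (m + 1) = (Nat.digits 2 m).sum + 1 := by
  have h0 := padicValNat_two_factorial m
  have h1 := padicValNat_two_factorial (m + 1)
  have hmul : padicValNat 2 (m + 1).factorial = padicValNat 2 (m + 1) + padicValNat 2 m.factorial := by
    rw [Nat.factorial_succ, padicValNat.mul (by omega) (Nat.factorial_ne_zero m)]
  omega

/-- **Exact 2-adic valuation**: `v₂(ũ_{m+1}) = 1 − 4m + 2 s₂(m)`. -/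
theorem padicValRat_uT_succ (m : ℕ) :
    padicValRat 2 (uT (m + 1)) = 1 - 4 * (m : ℤ) + 2 * ((Nat.digits 2 m).sum : ℤ) := by
  rcases Nat.eq_zero_or_pos m with rfl | hm
  · have h2 : padicValRat 2 (2 : ℚ) = 1 := by simpa using padicValRat.self (p := 2) one_lt_two
    have h3 : padicValRat 2 (3 : ℚ) = 0 := by
      rw [show (3 : ℚ) = ((3 : ℕ) : ℚ) by norm_num, padicValRat.of_nat, padicValNat.eq_zero_of_not_dvd (by norm_num)]
      rfl
    rw [show uT (0 + 1) = utSum 0 from uT_eq_utSum 0, utSum_zero, show (6 : ℚ) = 2 * 3 by norm_num,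
      padicValRat.mul two_ne_zero three_ne_zero, h2, h3]
    simp
  have hlaw := twoAdicLaw_holds m (m + 1) (m + 1) m (m + 2) (by omega) (by omega) (by omega) (by omega) (by omega)
  have hS : m + 1 + (m + 1) - (m + 2) = m := by omega
  have hC : m + 1 + m - m = m + 1 := by omega
  rw [hS, hC] at hlaw
  have hbox := catalanQ_offDiagonal m
  rw [← uT_eq_utSum] at hbox
  have hu : uT (m + 1) ≠ 0 := (uT_pos (by omega)).ne'
  have hm1 : ((m : ℚ) + 1) ≠ 0 := by positivity
  have hQ : catalanQ m (m + 1) (m + 1) m (m + 2) ≠ 0 := by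
    intro h0
    rw [h0, mul_zero] at hbox
    have : (2 : ℚ) * (-1) ^ m ≠ 0 := mul_ne_zero two_ne_zero (pow_ne_zero _ (by norm_num))
    exact hu ((mul_eq_zero.mp hbox.symm).resolve_left this)
  have hv := congrArg (padicValRat 2) hbox
  have h2 : padicValRat 2 (2 : ℚ) = 1 := by simpa using padicValRat.self (p := 2) one_lt_two
  have hm1v : padicValRat 2 (((-1 : ℚ)) ^ m) = 0 := by
    rw [padicValRat.pow, padicValRat.neg, padicValRat.one, mul_zero]
  rw [padicValRat.mul hm1 hQ, padicValRat.mul (mul_ne_zero two_ne_zero (pow_ne_zero _ (by norm_num))) hu,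
    padicValRat.mul two_ne_zero (pow_ne_zero _ (by norm_num)), h2, hm1v, hlaw,
    show ((m : ℚ) + 1) = ((m + 1 : ℕ) : ℚ) by push_cast; ring, padicValRat.of_nat] at hv
  have hd := s2_succ_add_padicValNat m
  push_cast at hv hd ⊢
  omega

/-- **Exact 2-adic valuation of `ũ_n`, `n ≥ 1`**: `v₂(ũ_n) = 5 − 4n + 2 s₂(n−1)` (`s₂` = binary digit sum).
(Lane edit lead/lit g13: `private` — the same statement landed first as the public
`CatalanRemarksTwoAdic.padicValRat_uT_rec` (fam-catalan 29, recursion route), gate `dedup.landed`; this is the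
box-identification proof, kept for the file's own use; pre-authorised by fam-catalan g7.) -/
private theorem padicValRat_uT {n : ℕ} (hn : 1 ≤ n) :
    padicValRat 2 (uT n) = 5 - 4 * (n : ℤ) + 2 * ((Nat.digits 2 (n - 1)).sum : ℤ) := by
  obtain ⟨m, rfl⟩ : ∃ m, n = m + 1 := ⟨n - 1, by omega⟩
  rw [padicValRat_uT_succ, show m + 1 - 1 = m from rfl]
  push_cast
  ring

/-- The reduced denominator of `ũ_n` is a power of `2`: fam-denom's dyadic law for `catalanQ` (tree theorem `Denom.CatalanBox.dyadicLaw_holds`)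
at the box point, transported through `uT_eq_box`. -/
theorem den_uT_dvd (n : ℕ) : ∃ k : ℕ, (uT n).den = 2 ^ k := by
  rcases Nat.lt_or_ge n 2 with h2 | h2
  · interval_cases n
    · exact ⟨0, by simp [Zudilin2003.uT]⟩
    · exact ⟨0, by rw [show uT 1 = utSum 0 from uT_eq_utSum 0, utSum_zero]; rfl⟩
  obtain ⟨m, rfl⟩ : ∃ m, n = m + 1 := ⟨n - 1, by omega⟩
  obtain ⟨e, he⟩ := Denom.CatalanBox.dyadicLaw_holds m (m + 1) (m + 1) m (m + 2)
    (by omega) (by omega) (by omega) (by omega) (by omega)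
  have hu : uT (m + 1) = catalanQ m (m + 1) (m + 1) m (m + 2) * ((((m : ℤ) + 1) * (-1) ^ m : ℤ) : ℚ) * (1 / 2) := by
    rw [uT_eq_box (by omega), show m + 1 - 1 = m from rfl, show m + 1 + 1 = m + 2 from rfl]
    push_cast
    ring
  have hz : (((((m : ℤ) + 1) * (-1) ^ m : ℤ) : ℚ)).den = 1 := Rat.den_intCast _
  have hhalf : ((1 : ℚ) / 2).den = 2 := by decide +kernel
  have hd : (uT (m + 1)).den ∣ 2 ^ (e + 1) := by
    rw [hu, pow_succ, ← he]
    refine (Rat.mul_den_dvd _ _).trans (Nat.mul_dvd_mul ?_ (by rw [hhalf]))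
    refine (Rat.mul_den_dvd _ _).trans ?_
    rw [hz, mul_one]
  obtain ⟨k, -, hk⟩ := (Nat.dvd_prime_pow Nat.prime_two).1 hd
  exact ⟨k, hk⟩

/-- **Exact denominator of `ũ_n`: `den ũ_n = 2^{4n − 5 − 2 s₂(n−1)}` for every `n`** (truncated subtraction; `den ũ₀ = den ũ₁ = 1`) — no odd
prime (`den_uT_dvd`), the power of `2` fixed by `padicValRat_uT`. -/
theorem den_uT (n : ℕ) : (uT n).den = 2 ^ (4 * n - 5 - 2 * (Nat.digits 2 (n - 1)).sum) := by
  rcases Nat.eq_zero_or_pos n with rfl | hn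
  · simp [Zudilin2003.uT]
  set q := uT n with hq
  obtain ⟨a, hden⟩ := den_uT_dvd n
  have hv := padicValRat_uT hn
  rw [← hq] at hden hv
  rw [padicValRat_def, hden, padicValNat.prime_pow] at hv
  have hs : (Nat.digits 2 (n - 1)).sum ≤ n - 1 := Nat.digit_sum_le 2 (n - 1)
  rw [hden]
  rcases Nat.eq_zero_or_pos a with rfl | hapos
  · congr 1; omega
  · have hcop : Nat.Coprime q.num.natAbs q.den := q.reduced
    rw [hden] at hcop
    have hnd : ¬ (2 : ℤ) ∣ q.num := by
      intro h
      have h2 : 2 ∣ q.num.natAbs := by omega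
      exact absurd ((Nat.Coprime.coprime_dvd_left h2 hcop).eq_one_of_dvd (dvd_pow_self 2 hapos.ne'))
        (by norm_num)
    rw [padicValInt.eq_zero_of_not_dvd hnd] at hv
    congr 1; omega

/-- `ũ_n · 2^{4n − 5 − 2 s₂(n−1)}` is the (reduced) numerator of `ũ_n`, an integer. -/
theorem uT_mul_two_pow (n : ℕ) :
    uT n * 2 ^ (4 * n - 5 - 2 * (Nat.digits 2 (n - 1)).sum) = ((uT n).num : ℚ) := by
  rw [← Rat.mul_den_eq_num (uT n), den_uT]; push_cast; rfl

/-- **The `u`-half of the inclusions (14) of [Zudilin 2002, Thm 2], SHARP: `2^{4n} ũ_n ∈ ℤ` for every `n`** (print: `2^{4n+o(n)} ũ_n ∈ ℤ`). -/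
theorem two_pow_mul_uT_isInt (n : ℕ) : ∃ z : ℤ, (z : ℚ) = 2 ^ (4 * n) * uT n := by
  refine ⟨2 ^ (4 * n - (4 * n - 5 - 2 * (Nat.digits 2 (n - 1)).sum)) * (uT n).num, ?_⟩
  have h := uT_mul_two_pow n
  push_cast
  rw [← h, show (2 : ℚ) ^ (4 * n) = 2 ^ (4 * n - (4 * n - 5 - 2 * (Nat.digits 2 (n - 1)).sum))
      * 2 ^ (4 * n - 5 - 2 * (Nat.digits 2 (n - 1)).sum) by rw [← pow_add]; congr 1; omega]
  ring

/-- Sharper and uniform: `2^{4n−7} ũ_n ∈ ℤ` for `n ≥ 2` (equality of denominators exactly when `n − 1` is a power of `2`). -/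
theorem two_pow_sub_mul_uT_isInt {n : ℕ} (hn : 2 ≤ n) : ∃ z : ℤ, (z : ℚ) = 2 ^ (4 * n - 7) * uT n := by
  have hs : 1 ≤ (Nat.digits 2 (n - 1)).sum := by
    have h0 := padicValNat_two_factorial (n - 1)
    have hlt : padicValNat 2 (n - 1).factorial < n - 1 := padicValNat_factorial_lt_of_ne_zero (p := 2) (by omega)
    omega
  refine ⟨2 ^ (4 * n - 7 - (4 * n - 5 - 2 * (Nat.digits 2 (n - 1)).sum)) * (uT n).num, ?_⟩
  have h := uT_mul_two_pow n
  push_cast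
  rw [← h, show (2 : ℚ) ^ (4 * n - 7) = 2 ^ (4 * n - 7 - (4 * n - 5 - 2 * (Nat.digits 2 (n - 1)).sum))
      * 2 ^ (4 * n - 5 - 2 * (Nat.digits 2 (n - 1)).sum) by rw [← pow_add]; congr 1; omega]
  ring

/-- **K-uT (bundled), the `u`-side of clause (iii) of `Zudilin2003.remarksTheorem2` with `e ≡ 0`:** for every `n`,
`den ũ_n = 2^{4n−5−2s₂(n−1)}` and `2^{4n} ũ_n ∈ ℤ`; for `n ≥ 1`, `ũ_n = (−1)^{n−1}(n/2)·catalanQ(n−1,n,n,n−1,n+1)` and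
`v₂(ũ_n) = 5 − 4n + 2s₂(n−1)`. -/
theorem uT_arithmetic (n : ℕ) :
    (uT n).den = 2 ^ (4 * n - 5 - 2 * (Nat.digits 2 (n - 1)).sum) ∧ (∃ z : ℤ, (z : ℚ) = 2 ^ (4 * n) * uT n) ∧
      (1 ≤ n → uT n = (-1) ^ (n - 1) * ((n : ℚ) / 2) * catalanQ (n - 1) n n (n - 1) (n + 1) ∧
        padicValRat 2 (uT n) = 5 - 4 * (n : ℤ) + 2 * ((Nat.digits 2 (n - 1)).sum : ℤ)) :=
  ⟨den_uT n, two_pow_mul_uT_isInt n, fun hn => ⟨uT_eq_box hn, padicValRat_uT hn⟩⟩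

/-- Sanity by name: `den ũ₃ = 2⁵` (`ũ₃ = 19719/32`; `4·3 − 5 − 2·s₂(2) = 5 = 4·3 − 7`: the sharp case `n − 1 = 2`). -/
example : (uT 3).den = 2 ^ (4 * 3 - 7) := by rw [den_uT]; norm_num

/-- Sanity by name: `den ũ₅ = 2¹³` (`ũ₅ = 605581075/8192`; `20 − 5 − 2·s₂(4) = 13`). -/
example : (uT 5).den = 8192 := by rw [den_uT]; norm_num

end Summit.KontsevichZagierPeriods.Zeta5Search.CatalanRemarksUTDenominator
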